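import Literature.MathematicalPhysics.QuantumFieldTheory.Balaban1983to89.B1Eq324BenfattoKernelEq324
import Literature.MathematicalPhysics.QuantumFieldTheory.Balaban1983to89.B1Eq324BenfattoEq324UnitRange
import HarnessLib

/-!
# `Balaban1983to89.B1Eq324BenfattoKernelEq324UnitRange` — [Balaban1982Higgs1] (3.24) p. 616 for the Gaussian field of a CLASS kernel
# ([BenfattoEtAl1978] Lemma p. 152, OUR class form of [Balaban1985BackgroundPropagators] Sect. E) FOR EVERY COUPLING `η ∈ (0, 1]`:
# print's «b₀ sufficiently large» ([Balaban1985UV3] (7) p. 257) in place of `η ≤ η₀`; no pad — PROVED, no definition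

statement-level skeleton of published theorems with citation tags; proofs where landed; nothing here is a claim about the
Yang–Mills mass gap

WHY THIS MODULE (cell `pub-ymgap`, seat `dag-n08-d` gen 14, INTENT-73 (announced bus 2026-08-28 13:49Z); node N08 [Balaban1985UV3]).  `…KernelEq324`
(p635433) gives (3.24) for `μ_K` on a window `η ≤ η₀`; seat n08-w4's `…Eq324UnitRange` (`eq324_of_sandwich_consts_on_unit`, `errTerm_pFun_le_on_unit`,
`lt_pFun_of_lt_b₀`) removes the window at the price of print's proviso `b* < b₀`.  This sequel re-issues the NO-PAD theorem for all couplings: the knit's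
threshold `b*` is ∃-hidden, so the statement reads `∃ b₁, ∀ b₀ > b₁, ∃ C, ∀ η ∈ (0,1], …` — the consumer takes «b₀ sufficiently large» as print does.  The
collar's two side conditions also hold on all of `(0,1]` once `b₀ ≥ 2/√γ_A` (`p(η) ≥ b₀`) and `γ_A b₀² ≥ 2κ` (the defect `e^{−γ_A p(η)²/2} ≤ η^κ`), whence
`b₁ = max b* (max (2/√γ_A) √(2κ/γ_A))`.  A separate module (not a v1.1 of `…KernelEq324`) to leave the landed file's imports untouched.

WHAT IS PROVED (standard axioms; no `sorry`; no definition).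
* ★★★ `eq324_of_classSigned_noPad_on_unit` — from the signed class shape at the collar constants (inline hypothesis, as `…KernelEq324` §3) and Λ-uniform
  growth rows: `∃ b₁, ∀ b₀ > b₁, ∃ C ≥ 0, ∀ η ∈ (0,1], ∀ member, ∀ (s, I ⊇ J, a)` with `I ≠ ∅`, `J ⊆ Λ`, `coefSup ≤ c·η^σ`:
  `0 < ∫Π_Δχ̂_{p(η)}e^{H_J}dμ_K ∧ |log ∫ − cumulantSum μ_K H_J t| ≤ C·η^κ·|I|`.
* ★★★★ `eq324_kernel_noPad_on_unit` — UNCONDITIONAL (∘ seat n08-c's `classBasicLemma_signed`, growth rows from `…ClassEntryRows`): member = `hK`, `Λ ≠ ∅`,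
  symmetry, `γ_A`-coercivity (`γ_A ≥ 2`, removable by seat n08-b's `…ClassRescale`), rows `J_c, M, M₂`.
HONEST SCOPE.  As `…KernelEq324`: OUR class form; the IDENT at [Balaban1985UV3]'s data is NOT claimed; count-neutral for N08; nothing about d = 4, the
continuum, OS axioms, a mass gap or the Clay problem.
-/

noncomputable section

open MeasureTheory Finset Matrix

namespace Literature.MathematicalPhysics.QuantumFieldTheory.Balaban1983to89.B1Eq324BenfattoKernelEq324UnitRange

open Literature.MathematicalPhysics.QuantumFieldTheory
open Literature.MathematicalPhysics.QuantumFieldTheory.Balaban1983to89.B1Eq324BenfattoLemma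
open Literature.MathematicalPhysics.QuantumFieldTheory.Balaban1983to89.B1Eq324BenfattoSpecialisation
open Literature.MathematicalPhysics.QuantumFieldTheory.Balaban1983to89.B1Eq324BenfattoEq324Signed
open Literature.MathematicalPhysics.QuantumFieldTheory.Balaban1983to89.B1Eq324BenfattoKernelCondField (condFieldK_empty)
open Literature.MathematicalPhysics.QuantumFieldTheory.Balaban1983to89.B1Eq324BenfattoKernelOfPrecision (isPosSemidefKernel_kernel)
open Literature.MathematicalPhysics.QuantumFieldTheory.Balaban1983to89.B1Eq324BenfattoClassAppendixC (posDef_of_coercive)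
open Literature.MathematicalPhysics.QuantumFieldTheory.Balaban1983to89.B1Eq324BenfattoKernelEq324

variable {d : ℕ}

/-- `1 ≤ 1 + log η⁻¹` on `(0, 1]` (private plumbing). [folklore] -/
private theorem one_le_one_add_log_inv {η : ℝ} (hη : 0 < η) (hη1 : η ≤ 1) : 1 ≤ 1 + Real.log η⁻¹ := by
  have := B10.log_inv_nonneg_of_le_one hη hη1
  linarith

/-- `e^{−Q} ≤ η^κ` once `κ(1 + log η⁻¹) ≤ Q`, `κ ≥ 0` (private plumbing). [folklore] -/
private theorem exp_neg_le_rpow {η κ Q : ℝ} (hη : 0 < η) (hκ : 0 ≤ κ) (hQ : κ * (1 + Real.log η⁻¹) ≤ Q) :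
    Real.exp (-Q) ≤ η ^ κ := by
  have hηκ : η ^ κ = Real.exp (κ - κ * (1 + Real.log η⁻¹)) := by
    rw [Real.rpow_def_of_pos hη, Real.log_inv]
    congr 1
    ring
  rw [hηκ]
  exact Real.exp_le_exp.mpr (by nlinarith)

/-! ## §1  All couplings `η ∈ (0, 1]`: print's «b₀ sufficiently large» in place of `η ≤ η₀` -/

/-- ★★★ **(3.24) FOR THE GAUSSIAN FIELD OF A CLASS KERNEL, NO PAD, FOR EVERY COUPLING `η ∈ (0, 1]`.**  As `eq324_of_classSigned_noPad`, but the three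
`η`-thresholds are replaced by ONE condition on the threshold scale `b₀` (print: «b₀ a sufficiently large absolute constant», [Balaban1985UV3] (7) p.257):
`∃ b₁, ∀ b₀ > b₁, ∃ C ≥ 0, ∀ η ∈ (0,1], ∀ member, ∀ instance: 0 < ∫Π_Δχ̂_{p(η)}e^{H_J}dμ_K ∧ |log ∫ − cumulantSum μ_K H_J t| ≤ C·η^κ·|I|`
(`b₁ = max b* (max (2/√γ_A) √(2κ/γ_A))`: seat n08-w4's `…Eq324UnitRange.errTerm_pFun_le_on_unit` and `lt_pFun_of_lt_b₀` for the printed error and the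
lemma's threshold; `p(η) ≥ b₀ ≥ 2/√γ_A` for the collar's Appendix A; `γ_A p(η)²/2 ≥ κ(1 + log η⁻¹)` from `γ_A b₀² ≥ 2κ` for the collar defect).
[cite: Balaban1982Higgs1, (3.24) p.616; Balaban1985UV3, (7) p.257; BenfattoEtAl1978, Lemma (4.5)–(4.7) p.152; Balaban1985BackgroundPropagators, Sect. E p.428 (class form; collar ours)] -/
theorem eq324_of_classSigned_noPad_on_unit {γA Jc θ V M V₂ M₂ V₄ : ℝ} (hγA0 : 0 < γA) (hJc0 : 0 ≤ Jc)
    (h :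
    ∃ bstar : ℝ, ∀ (t D : ℕ) (ϰ : ℝ), 0 < ϰ →
      ∃ S ρ₁ ρ₂ ρ₃ ρ₄ : ℝ, 0 ≤ S ∧ 0 < ρ₃ ∧
        ∀ {Λ : Finset (B1Eq324BenfattoLemma.Site d)} {A : Matrix Λ Λ ℝ} {K : B1Eq324BenfattoLemma.Site d → B1Eq324BenfattoLemma.Site d → ℝ},
          (∀ x y, K x y = if h : x ∈ Λ ∧ y ∈ Λ then (A⁻¹ : Matrix Λ Λ ℝ) ⟨x, h.1⟩ ⟨y, h.2⟩ else 0) → Λ.Nonempty →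
          (∀ e e', A e e' = A e' e) → (∀ x : Λ → ℝ, γA * ∑ e, x e ^ 2 ≤ ∑ e, ∑ e', A e e' * x e * x e') →
          (∀ e : Λ, ∑ e' : Λ, |A e e'| * (Real.cosh (θ * Real.sqrt (∑ j, ((((e : B1Eq324BenfattoLemma.Site d) j : ℝ) - ((e' : B1Eq324BenfattoLemma.Site d) j : ℝ))) ^ 2)) - 1) ≤ Jc) →
          (∀ e : Λ, ∑ e' : Λ, Real.exp (-(θ * Real.sqrt (∑ j, ((((e : B1Eq324BenfattoLemma.Site d) j : ℝ) - ((e' : B1Eq324BenfattoLemma.Site d) j : ℝ))) ^ 2))) *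
            (1 + Real.sqrt (∑ j, ((((e : B1Eq324BenfattoLemma.Site d) j : ℝ) - ((e' : B1Eq324BenfattoLemma.Site d) j : ℝ))) ^ 2)) ≤ V) →
          (∀ e : Λ, ∑ e' : Λ, |A e e'| * (1 + Real.sqrt (∑ j, ((((e : B1Eq324BenfattoLemma.Site d) j : ℝ) - ((e' : B1Eq324BenfattoLemma.Site d) j : ℝ))) ^ 2)) ≤ max M γA) →
          (∀ e : Λ, ∑ e' : Λ, Real.exp (-(θ / 2 * Real.sqrt (∑ j, ((((e : B1Eq324BenfattoLemma.Site d) j : ℝ) - ((e' : B1Eq324BenfattoLemma.Site d) j : ℝ))) ^ 2))) ≤ V₂) →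
          (∀ e : Λ, ∑ e' : Λ, |A e e'| * Real.exp (θ / 2 * Real.sqrt (∑ j, ((((e : B1Eq324BenfattoLemma.Site d) j : ℝ) - ((e' : B1Eq324BenfattoLemma.Site d) j : ℝ))) ^ 2)) ≤ max M₂ γA) →
          (∀ e : Λ, ∑ e' : Λ, Real.exp (-(θ / 4 * Real.sqrt (∑ j, ((((e : B1Eq324BenfattoLemma.Site d) j : ℝ) - ((e' : B1Eq324BenfattoLemma.Site d) j : ℝ))) ^ 2))) *
            (1 + Real.sqrt (∑ j, ((((e : B1Eq324BenfattoLemma.Site d) j : ℝ) - ((e' : B1Eq324BenfattoLemma.Site d) j : ℝ))) ^ 2)) ≤ V₄) →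
          ∀ (s : ℕ) (b : ℝ), bstar < b → ∀ (I J : Finset (B1Eq324BenfattoLemma.Site d)), I.Nonempty → J ⊆ I →
            (∀ x ∈ J, ∀ z : B1Eq324BenfattoLemma.Site d, (∀ i, ((|z i - x i| : ℤ) : ℝ) ≤ b ^ 2) → z ∈ Λ) → ∀ a : Coef d,
            (∀ (C : Finset (B1Eq324BenfattoLemma.Site d)) (zbar : B1Eq324BenfattoLemma.Site d → ℝ), C ⊆ Λ →
                (∀ c ∈ C, ∀ x ∈ J, b ^ 3 + Real.sqrt d * (b ^ 2 + 1) ≤ Real.sqrt (∑ j, (((x j : ℝ) - (c j : ℝ))) ^ 2)) →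
                ∫ z, cutoffBoltzmann (hamiltonian s D ϰ a J) I b z ∂((gaussianFieldOfKernel (condCov K C)).map
                    fun (ζ' : B1Eq324BenfattoLemma.Site d → ℝ) (x : B1Eq324BenfattoLemma.Site d) => condMean K C zbar x + ζ' x) ≤
                  Real.exp (cumulantSum (gaussianFieldOfKernel K) (hamiltonian s D ϰ a J) t +
                    (I.card : ℝ) * errTerm S ρ₁ ρ₂ ρ₃ ρ₄ (coefSup s D a J) b t)) ∧
            Real.exp (cumulantSum (gaussianFieldOfKernel K) (hamiltonian s D ϰ a J) t -
                  (I.card : ℝ) * errTerm S ρ₁ ρ₂ ρ₃ ρ₄ (coefSup s D a J) b t) ≤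
                ∫ z, cutoffBoltzmann (hamiltonian s D ϰ a J) I b z ∂gaussianFieldOfKernel K)
    (hVu : (∀ (Λ₀ : Finset (B1Eq324BenfattoLemma.Site d)) (e : Λ₀), ∑ e' : Λ₀, Real.exp (-(θ * Real.sqrt (∑ j, ((((e : B1Eq324BenfattoLemma.Site d) j : ℝ) - ((e' : B1Eq324BenfattoLemma.Site d) j : ℝ))) ^ 2))) *
        (1 + Real.sqrt (∑ j, ((((e : B1Eq324BenfattoLemma.Site d) j : ℝ) - ((e' : B1Eq324BenfattoLemma.Site d) j : ℝ))) ^ 2)) ≤ V))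
    (hV₂u : (∀ (Λ₀ : Finset (B1Eq324BenfattoLemma.Site d)) (e : Λ₀), ∑ e' : Λ₀, Real.exp (-(θ / 2 * Real.sqrt (∑ j, ((((e : B1Eq324BenfattoLemma.Site d) j : ℝ) - ((e' : B1Eq324BenfattoLemma.Site d) j : ℝ))) ^ 2))) ≤ V₂))
    (hV₄u : (∀ (Λ₀ : Finset (B1Eq324BenfattoLemma.Site d)) (e : Λ₀), ∑ e' : Λ₀, Real.exp (-(θ / 4 * Real.sqrt (∑ j, ((((e : B1Eq324BenfattoLemma.Site d) j : ℝ) - ((e' : B1Eq324BenfattoLemma.Site d) j : ℝ))) ^ 2))) *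
        (1 + Real.sqrt (∑ j, ((((e : B1Eq324BenfattoLemma.Site d) j : ℝ) - ((e' : B1Eq324BenfattoLemma.Site d) j : ℝ))) ^ 2)) ≤ V₄))
    (t D : ℕ) {ϰ : ℝ} (hϰ : 0 < ϰ) {p₀ σ c κ : ℝ} (hp₀ : 2 / 3 < p₀) (hσ : 0 < σ) (hc : 0 ≤ c) (hκ : 0 < κ)
    (hκσ : κ < σ * (t + 1)) :
    ∃ b₁ : ℝ, ∀ b₀ : ℝ, b₁ < b₀ → ∃ C : ℝ, 0 ≤ C ∧ ∀ η : ℝ, 0 < η → η ≤ 1 →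
      ∀ {Λ : Finset (B1Eq324BenfattoLemma.Site d)} {A : Matrix Λ Λ ℝ} {K : B1Eq324BenfattoLemma.Site d → B1Eq324BenfattoLemma.Site d → ℝ},
        (∀ x y, K x y = if h : x ∈ Λ ∧ y ∈ Λ then (A⁻¹ : Matrix Λ Λ ℝ) ⟨x, h.1⟩ ⟨y, h.2⟩ else 0) → Λ.Nonempty →
        (∀ e e', A e e' = A e' e) → (∀ x : Λ → ℝ, γA * ∑ e, x e ^ 2 ≤ ∑ e, ∑ e', A e e' * x e * x e') →
        (∀ e : Λ, ∑ e' : Λ, |A e e'| * (Real.cosh (θ * Real.sqrt (∑ j, ((((e : B1Eq324BenfattoLemma.Site d) j : ℝ) - ((e' : B1Eq324BenfattoLemma.Site d) j : ℝ))) ^ 2)) - 1) ≤ Jc) →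
        (∀ e : Λ, ∑ e' : Λ, |A e e'| * (1 + Real.sqrt (∑ j, ((((e : B1Eq324BenfattoLemma.Site d) j : ℝ) - ((e' : B1Eq324BenfattoLemma.Site d) j : ℝ))) ^ 2)) ≤ M) →
        (∀ e : Λ, ∑ e' : Λ, |A e e'| * Real.exp (θ / 2 * Real.sqrt (∑ j, ((((e : B1Eq324BenfattoLemma.Site d) j : ℝ) - ((e' : B1Eq324BenfattoLemma.Site d) j : ℝ))) ^ 2)) ≤ M₂) →
        ∀ (s : ℕ) (I J : Finset (B1Eq324BenfattoLemma.Site d)) (a : Coef d), I.Nonempty → J ⊆ I → J ⊆ Λ →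
          coefSup s D a J ≤ c * η ^ σ →
          0 < ∫ z, cutoffBoltzmann (hamiltonian s D ϰ a J) I (B10.pFun b₀ p₀ η) z ∂gaussianFieldOfKernel K ∧
            |Real.log (∫ z, cutoffBoltzmann (hamiltonian s D ϰ a J) I (B10.pFun b₀ p₀ η) z ∂gaussianFieldOfKernel K) -
                cumulantSum (gaussianFieldOfKernel K) (hamiltonian s D ϰ a J) t| ≤ C * η ^ κ * I.card := by
  classical
  obtain ⟨bstar, hBL⟩ := h
  obtain ⟨S, ρ₁, ρ₂, ρ₃, ρ₄, hS, hρ₃, hall⟩ := hBL t D ϰ hϰ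
  refine ⟨max bstar (max (2 / Real.sqrt γA) (Real.sqrt (2 * κ / γA))), fun b₀ hb₁ => ?_⟩
  have hsq0 : 0 < Real.sqrt γA := Real.sqrt_pos.mpr hγA0
  have h2s : 0 < 2 / Real.sqrt γA := by positivity
  have hb₀ : 0 < b₀ := lt_trans h2s (lt_of_le_of_lt ((le_max_left _ _).trans (le_max_right _ _)) hb₁)
  have hbw : bstar < b₀ := lt_of_le_of_lt (le_max_left _ _) hb₁
  have hb2 : 2 / Real.sqrt γA < b₀ := lt_of_le_of_lt ((le_max_left _ _).trans (le_max_right _ _)) hb₁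
  have hbκ : Real.sqrt (2 * κ / γA) < b₀ := lt_of_le_of_lt ((le_max_right _ _).trans (le_max_right _ _)) hb₁
  obtain ⟨C₁, hC₁, hE₁⟩ := B1Eq324BenfattoEq324UnitRange.errTerm_pFun_le_on_unit ρ₁ ρ₂ ρ₄ t hS hρ₃ hb₀ hp₀ hσ hc hκ hκσ
  refine ⟨C₁ + 4 * 8 ^ d, by positivity, ?_⟩
  intro η hη hη1 Λ A K hK hΛne hAs hγA hJc hM hM₂ s I J a hI hJI hJΛ hAc
  set b : ℝ := B10.pFun b₀ p₀ η with hbdef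
  -- the threshold bounds, now for every `η ≤ 1`
  have hL1 : 1 ≤ 1 + Real.log η⁻¹ := one_le_one_add_log_inv hη hη1
  have hL0 : 0 < 1 + Real.log η⁻¹ := lt_of_lt_of_le one_pos hL1
  have hbb₀ : b₀ ≤ b := by
    rw [hbdef]
    unfold B10.pFun
    have : (1 : ℝ) ≤ (1 + Real.log η⁻¹) ^ p₀ := Real.one_le_rpow hL1 (by linarith)
    nlinarith
  have hbstar : bstar < b := B1Eq324BenfattoEq324UnitRange.lt_pFun_of_lt_b₀ hbw hb₀ (by linarith) hη hη1
  have hbpos : 0 < b := lt_of_lt_of_le hb₀ hbb₀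
  have hbc : 4 * γA⁻¹ ≤ b ^ 2 := by
    have h1 : 2 / Real.sqrt γA ≤ b := le_trans hb2.le hbb₀
    have h2 : (2 / Real.sqrt γA) ^ 2 = 4 * γA⁻¹ := by
      rw [div_pow, Real.sq_sqrt hγA0.le]; ring
    rw [← h2]
    exact pow_le_pow_left₀ h2s.le h1 2
  -- the collar defect on all of `(0,1]`: `γ_A p(η)²/2 ≥ κ(1 + log η⁻¹)` from `γ_A b₀² ≥ 2κ`
  have hdefect : Real.exp (-(b ^ 2 / (2 * γA⁻¹))) ≤ η ^ κ := by
    refine exp_neg_le_rpow hη hκ.le ?_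
    have hb₀2 : 2 * κ / γA ≤ b₀ ^ 2 := by
      have h0 : 0 ≤ 2 * κ / γA := by positivity
      have := pow_le_pow_left₀ (Real.sqrt_nonneg _) hbκ.le 2
      rwa [Real.sq_sqrt h0] at this
    have hsq : b ^ 2 = b₀ ^ 2 * (1 + Real.log η⁻¹) ^ (2 * p₀) := by rw [hbdef, pFun_sq_eq b₀ hη hη1]
    have hpow : (1 + Real.log η⁻¹) ≤ (1 + Real.log η⁻¹) ^ (2 * p₀) := by
      conv_lhs => rw [← Real.rpow_one (1 + Real.log η⁻¹)]
      exact Real.rpow_le_rpow_of_exponent_le hL1 (by linarith)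
    have hb₀2' : 2 * κ ≤ γA * b₀ ^ 2 := by
      have := mul_le_mul_of_nonneg_left hb₀2 hγA0.le
      rwa [mul_div_cancel₀ _ hγA0.ne'] at this
    calc κ * (1 + Real.log η⁻¹) ≤ γA * b₀ ^ 2 / 2 * (1 + Real.log η⁻¹) := by
          have := mul_le_mul_of_nonneg_right hb₀2' hL0.le
          linarith
      _ ≤ γA * b₀ ^ 2 / 2 * (1 + Real.log η⁻¹) ^ (2 * p₀) := mul_le_mul_of_nonneg_left hpow (by positivity)
      _ = b ^ 2 / (2 * γA⁻¹) := by rw [hsq]; field_simp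
  -- THE COLLAR: pad, region, member
  set R : ℤ := ⌊b ^ 2⌋ with hR
  set pad : Finset (B1Eq324BenfattoLemma.Site d) :=
    J.biUnion fun x => Fintype.piFinset fun i => Finset.Icc (x i - R) (x i + R) with hpad_def
  set Λ' : Finset (B1Eq324BenfattoLemma.Site d) := Λ ∪ (pad \ Λ) with hΛ'
  have hΛ : Λ ⊆ Λ' := Finset.subset_union_left
  set A' : Matrix Λ' Λ' ℝ := Matrix.of fun e e' =>
    if h : (e : B1Eq324BenfattoLemma.Site d) ∈ Λ ∧ (e' : B1Eq324BenfattoLemma.Site d) ∈ Λ then A ⟨e, h.1⟩ ⟨e', h.2⟩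
    else if e = e' then γA else 0 with hA'
  have hAA : ∀ (e e' : Λ') (he : (e : B1Eq324BenfattoLemma.Site d) ∈ Λ) (he' : (e' : B1Eq324BenfattoLemma.Site d) ∈ Λ),
      A' e e' = A ⟨e, he⟩ ⟨e', he'⟩ := fun e e' he he' => by
    rw [hA', Matrix.of_apply, dif_pos ⟨he, he'⟩]
  have hcross₁ : ∀ e e' : Λ', (e : B1Eq324BenfattoLemma.Site d) ∈ Λ → (e' : B1Eq324BenfattoLemma.Site d) ∉ Λ → A' e e' = 0 :=
    fun e e' he he' => by
      have hne : e ≠ e' := fun h => he' (h ▸ he)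
      rw [hA', Matrix.of_apply, dif_neg (fun h => he' h.2), if_neg hne]
  have hcross₂ : ∀ e e' : Λ', (e : B1Eq324BenfattoLemma.Site d) ∉ Λ → (e' : B1Eq324BenfattoLemma.Site d) ∈ Λ → A' e e' = 0 :=
    fun e e' he he' => by
      have hne : e ≠ e' := fun h => he (h ▸ he')
      rw [hA', Matrix.of_apply, dif_neg (fun h => he h.1), if_neg hne]
  have hdiag : ∀ e e' : Λ', (e : B1Eq324BenfattoLemma.Site d) ∉ Λ → (e' : B1Eq324BenfattoLemma.Site d) ∉ Λ →
      A' e e' = if e = e' then γA else 0 := fun e e' he _ => by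
    rw [hA', Matrix.of_apply, dif_neg (fun h => he h.1)]
  -- the collar member's rows
  have hAs' := B1Eq324BenfattoClassCollar.symm_collar (c := γA) hAs hAA hcross₁ hcross₂ hdiag
  have hγA' := B1Eq324BenfattoClassCollar.coercive_collar hΛ hγA le_rfl hAA hcross₁ hcross₂ hdiag
  have hApd : A.PosDef := posDef_of_coercive hAs hγA0 hγA
  have hA'pd : A'.PosDef := posDef_of_coercive hAs' hγA0 hγA'
  have hJc' : ∀ e : Λ', ∑ e' : Λ', |A' e e'| *
      (Real.cosh (θ * Real.sqrt (∑ j, ((((e : B1Eq324BenfattoLemma.Site d) j : ℝ) - ((e' : B1Eq324BenfattoLemma.Site d) j : ℝ))) ^ 2)) - 1) ≤ Jc := by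
    intro e
    have h := B1Eq324BenfattoClassCollar.row_collar_le hΛ
      (fun x y : B1Eq324BenfattoLemma.Site d => Real.cosh (θ * Real.sqrt (∑ j, (((x j : ℝ) - (y j : ℝ))) ^ 2)) - 1) (R := Jc) (w₀ := 0)
      hJc (fun e _ => by simp) hAA hcross₁ hcross₂ hdiag e
    rwa [mul_zero, max_eq_left hJc0] at h
  have hM' : ∀ e : Λ', ∑ e' : Λ', |A' e e'| *
      (1 + Real.sqrt (∑ j, ((((e : B1Eq324BenfattoLemma.Site d) j : ℝ) - ((e' : B1Eq324BenfattoLemma.Site d) j : ℝ))) ^ 2)) ≤ max M γA := by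
    intro e
    have h := B1Eq324BenfattoClassCollar.row_collar_le hΛ
      (fun x y : B1Eq324BenfattoLemma.Site d => 1 + Real.sqrt (∑ j, (((x j : ℝ) - (y j : ℝ))) ^ 2)) (R := M) (w₀ := 1)
      hM (fun e _ => by simp) hAA hcross₁ hcross₂ hdiag e
    rwa [mul_one, abs_of_pos hγA0] at h
  have hM₂' : ∀ e : Λ', ∑ e' : Λ', |A' e e'| *
      Real.exp (θ / 2 * Real.sqrt (∑ j, ((((e : B1Eq324BenfattoLemma.Site d) j : ℝ) - ((e' : B1Eq324BenfattoLemma.Site d) j : ℝ))) ^ 2)) ≤ max M₂ γA := by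
    intro e
    have h := B1Eq324BenfattoClassCollar.row_collar_le hΛ
      (fun x y : B1Eq324BenfattoLemma.Site d => Real.exp (θ / 2 * Real.sqrt (∑ j, (((x j : ℝ) - (y j : ℝ))) ^ 2))) (R := M₂) (w₀ := 1)
      hM₂ (fun e _ => by simp) hAA hcross₁ hcross₂ hdiag e
    rwa [mul_one, abs_of_pos hγA0] at h
  -- the lemma's pad holds in `Λ'`
  have hpad' : ∀ x ∈ J, ∀ z : B1Eq324BenfattoLemma.Site d, (∀ i, ((|z i - x i| : ℤ) : ℝ) ≤ b ^ 2) → z ∈ Λ' := by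
    intro x hx z hz
    have hzpad : z ∈ pad := by
      rw [hpad_def, Finset.mem_biUnion]
      refine ⟨x, hx, Fintype.mem_piFinset.mpr fun i => Finset.mem_Icc.mpr ?_⟩
      have hi : |z i - x i| ≤ R := Int.le_floor.mpr (hz i)
      constructor <;> linarith [(abs_le.mp hi).1, (abs_le.mp hi).2]
    rw [hΛ', Finset.mem_union, Finset.mem_sdiff]
    by_cases hzΛ : z ∈ Λ
    · exact Or.inl hzΛ
    · exact Or.inr ⟨hzpad, hzΛ⟩
  -- the class Basic Lemma for the collar member
  set K' : B1Eq324BenfattoLemma.Site d → B1Eq324BenfattoLemma.Site d → ℝ := fun x y =>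
    if h : x ∈ Λ' ∧ y ∈ Λ' then (A'⁻¹ : Matrix Λ' Λ' ℝ) ⟨x, h.1⟩ ⟨y, h.2⟩ else 0 with hK'def
  have hK' : ∀ x y, K' x y = if h : x ∈ Λ' ∧ y ∈ Λ' then (A'⁻¹ : Matrix Λ' Λ' ℝ) ⟨x, h.1⟩ ⟨y, h.2⟩ else 0 := fun _ _ => rfl
  obtain ⟨h46, h47⟩ := hall hK' (hΛne.mono hΛ) hAs' hγA' hJc' (fun e => hVu Λ' e) hM' (fun e => hV₂u Λ' e) hM₂' (fun e => hV₄u Λ' e)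
    s b hbstar I J hI hJI hpad' a
  have hup' := h46 ∅ (fun _ => 0) (Finset.empty_subset _) (fun c hc => absurd hc (Finset.notMem_empty _))
  rw [condFieldK_empty] at hup'
  -- transfer to `μ_K`
  have hAunit : IsUnit A.det := (Matrix.isUnit_iff_isUnit_det A).mp hApd.isUnit
  have hsum : ∀ x y, K' x y = K x y + (fun x y : B1Eq324BenfattoLemma.Site d => if x = y ∧ x ∈ Λ' ∧ x ∉ Λ then γA⁻¹ else 0) x y :=
    fun x y => B1Eq324BenfattoClassCollar.kernel_collar_eq_add hΛ hAunit hγA0.ne' hAA hcross₁ hcross₂ hdiag hK hK' x y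
  have hK0 : ∀ x y, (x ∉ Λ ∨ y ∉ Λ) → K x y = 0 := by
    intro x y hxy
    rw [hK]
    exact dif_neg fun h => hxy.elim (fun hx => hx h.1) (fun hy => hy h.2)
  have hKP0 : ∀ x y, (x ∉ Λ' \ Λ ∨ y ∉ Λ' \ Λ) →
      (fun x y : B1Eq324BenfattoLemma.Site d => if x = y ∧ x ∈ Λ' ∧ x ∉ Λ then γA⁻¹ else 0) x y = 0 := by
    intro x y hxy
    simp only
    refine if_neg fun h => ?_
    obtain ⟨rfl, hx', hxΛ⟩ := h
    exact hxy.elim (fun hx => hx (Finset.mem_sdiff.mpr ⟨hx', hxΛ⟩)) (fun hy => hy (Finset.mem_sdiff.mpr ⟨hx', hxΛ⟩))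
  have hKPC : ∀ x, (fun x y : B1Eq324BenfattoLemma.Site d => if x = y ∧ x ∈ Λ' ∧ x ∉ Λ then γA⁻¹ else 0) x x ≤ γA⁻¹ := by
    intro x
    simp only
    split_ifs
    · exact le_rfl
    · exact inv_nonneg.mpr hγA0.le
  obtain ⟨hlowK, hupK⟩ := B1Eq324BenfattoClassCollar.sandwich_of_collar_sandwich (isPosSemidefKernel_kernel hK hApd)
    (isPosSemidefKernel_kernel hK' hA'pd) (B1Eq324BenfattoClassCollar.isPosSemidefKernel_collarDiag (Λ := Λ) (Λ' := Λ') hγA0)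
    Finset.disjoint_sdiff hsum hK0 hKP0 (inv_pos.mpr hγA0) hKPC a hJΛ hI hbpos hbc t h47 hup'
  -- the two error pieces at the threshold
  have hI0 : (0 : ℝ) ≤ I.card := Nat.cast_nonneg _
  have hδ0 : 0 ≤ (I.card : ℝ) * (4 * 8 ^ d * Real.exp (-(b ^ 2 / (2 * γA⁻¹)))) :=
    mul_nonneg hI0 (mul_nonneg (mul_nonneg (by norm_num) (pow_nonneg (by norm_num) d)) (Real.exp_pos _).le)
  have hlow2 : Real.exp (cumulantSum (gaussianFieldOfKernel K) (hamiltonian s D ϰ a J) t -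
      ((I.card : ℝ) * errTerm S ρ₁ ρ₂ ρ₃ ρ₄ (coefSup s D a J) b t + (I.card : ℝ) * (4 * 8 ^ d * Real.exp (-(b ^ 2 / (2 * γA⁻¹)))))) ≤
      ∫ z, cutoffBoltzmann (hamiltonian s D ϰ a J) I b z ∂gaussianFieldOfKernel K :=
    le_trans (Real.exp_le_exp.mpr (by linarith)) hlowK
  have hup2 : ∫ z, cutoffBoltzmann (hamiltonian s D ϰ a J) I b z ∂gaussianFieldOfKernel K ≤
      Real.exp (cumulantSum (gaussianFieldOfKernel K) (hamiltonian s D ϰ a J) t +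
        ((I.card : ℝ) * errTerm S ρ₁ ρ₂ ρ₃ ρ₄ (coefSup s D a J) b t + (I.card : ℝ) * (4 * 8 ^ d * Real.exp (-(b ^ 2 / (2 * γA⁻¹)))))) := by
    rw [← add_assoc]; exact hupK
  obtain ⟨hpos, habs⟩ := pos_and_abs_log_sub_le_of_sandwich hlow2 hup2
  refine ⟨hpos, habs.trans ?_⟩
  have herr : errTerm S ρ₁ ρ₂ ρ₃ ρ₄ (coefSup s D a J) b t ≤ C₁ * η ^ κ :=
    hE₁ η (coefSup s D a J) hη hη1 (coefSup_nonneg s D a J) hAc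
  have hdef : 4 * 8 ^ d * Real.exp (-(b ^ 2 / (2 * γA⁻¹))) ≤ 4 * 8 ^ d * η ^ κ :=
    mul_le_mul_of_nonneg_left hdefect (mul_nonneg (by norm_num) (pow_nonneg (by norm_num) d))
  have h1 := mul_le_mul_of_nonneg_left herr hI0
  have h2 := mul_le_mul_of_nonneg_left hdef hI0
  calc (I.card : ℝ) * errTerm S ρ₁ ρ₂ ρ₃ ρ₄ (coefSup s D a J) b t + (I.card : ℝ) * (4 * 8 ^ d * Real.exp (-(b ^ 2 / (2 * γA⁻¹))))
      ≤ (I.card : ℝ) * (C₁ * η ^ κ) + (I.card : ℝ) * (4 * 8 ^ d * η ^ κ) := add_le_add h1 h2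
    _ = (C₁ + 4 * 8 ^ d) * η ^ κ * I.card := by ring


/-- ★★★★ **(3.24) FOR THE GAUSSIAN FIELD OF EVERY CLASS MEMBER, UNCONDITIONAL, NO PAD, FOR EVERY COUPLING `η ∈ (0,1]`** (`eq324_of_classSigned_noPad_on_unit`
∘ seat n08-c's `classBasicLemma_signed`, growth rows from `…ClassEntryRows`): for `0 < d`, `2 ≤ γ_A`, `0 ≤ J_c < γ_A`, `θ > 0`, `M, M₂ ≥ 0`, every `t D ϰ p₀ σ c`,
`0 < κ < σ(t+1)`: `∃ b₁, ∀ b₀ > b₁, ∃ C ≥ 0, ∀ η ∈ (0,1]`, every member with ONLY (`hK`, `Λ ≠ ∅`, symmetry, `γ_A`-coercivity, rows `J_c, M, M₂`) and every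
`(s, I ⊇ J, a)`, `I ≠ ∅`, `J ⊆ Λ`, `coefSup ≤ c·η^σ`: the (3.24) pair.
[cite: Balaban1982Higgs1, (3.24) p.616; Balaban1985UV3, (7) p.257; BenfattoEtAl1978, Lemma (4.5)–(4.7) p.152; Balaban1985BackgroundPropagators, Sect. E p.428 (class form; ours)] -/
theorem eq324_kernel_noPad_on_unit (hd : 0 < d) {γA Jc θ M M₂ : ℝ} (hγA2 : 2 ≤ γA) (hJc0 : 0 ≤ Jc) (hJcγ : Jc < γA) (hθ : 0 < θ)
    (hM0 : 0 ≤ M) (hM₂0 : 0 ≤ M₂)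
    (t D : ℕ) {ϰ : ℝ} (hϰ : 0 < ϰ) {p₀ σ c κ : ℝ} (hp₀ : 2 / 3 < p₀) (hσ : 0 < σ) (hc : 0 ≤ c) (hκ : 0 < κ)
    (hκσ : κ < σ * (t + 1)) :
    ∃ b₁ : ℝ, ∀ b₀ : ℝ, b₁ < b₀ → ∃ C : ℝ, 0 ≤ C ∧ ∀ η : ℝ, 0 < η → η ≤ 1 →
      ∀ {Λ : Finset (B1Eq324BenfattoLemma.Site d)} {A : Matrix Λ Λ ℝ} {K : B1Eq324BenfattoLemma.Site d → B1Eq324BenfattoLemma.Site d → ℝ},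
        (∀ x y, K x y = if h : x ∈ Λ ∧ y ∈ Λ then (A⁻¹ : Matrix Λ Λ ℝ) ⟨x, h.1⟩ ⟨y, h.2⟩ else 0) → Λ.Nonempty →
        (∀ e e', A e e' = A e' e) → (∀ x : Λ → ℝ, γA * ∑ e, x e ^ 2 ≤ ∑ e, ∑ e', A e e' * x e * x e') →
        (∀ e : Λ, ∑ e' : Λ, |A e e'| * (Real.cosh (θ * Real.sqrt (∑ j, ((((e : B1Eq324BenfattoLemma.Site d) j : ℝ) - ((e' : B1Eq324BenfattoLemma.Site d) j : ℝ))) ^ 2)) - 1) ≤ Jc) →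
        (∀ e : Λ, ∑ e' : Λ, |A e e'| * (1 + Real.sqrt (∑ j, ((((e : B1Eq324BenfattoLemma.Site d) j : ℝ) - ((e' : B1Eq324BenfattoLemma.Site d) j : ℝ))) ^ 2)) ≤ M) →
        (∀ e : Λ, ∑ e' : Λ, |A e e'| * Real.exp (θ / 2 * Real.sqrt (∑ j, ((((e : B1Eq324BenfattoLemma.Site d) j : ℝ) - ((e' : B1Eq324BenfattoLemma.Site d) j : ℝ))) ^ 2)) ≤ M₂) →
        ∀ (s : ℕ) (I J : Finset (B1Eq324BenfattoLemma.Site d)) (a : Coef d), I.Nonempty → J ⊆ I → J ⊆ Λ →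
          coefSup s D a J ≤ c * η ^ σ →
          0 < ∫ z, cutoffBoltzmann (hamiltonian s D ϰ a J) I (B10.pFun b₀ p₀ η) z ∂gaussianFieldOfKernel K ∧
            |Real.log (∫ z, cutoffBoltzmann (hamiltonian s D ϰ a J) I (B10.pFun b₀ p₀ η) z ∂gaussianFieldOfKernel K) -
                cumulantSum (gaussianFieldOfKernel K) (hamiltonian s D ϰ a J) t| ≤ C * η ^ κ * I.card := by
  classical
  have hγA0 : 0 < γA := by linarith
  have hone : ((0 : B1Eq324BenfattoLemma.Site d)) ∈ ({0} : Finset (B1Eq324BenfattoLemma.Site d)) := Finset.mem_singleton_self _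
  have hrow_nonneg : ∀ (w : B1Eq324BenfattoLemma.Site d → B1Eq324BenfattoLemma.Site d → ℝ), (∀ x y, 0 ≤ w x y) →
      ∀ {B : ℝ}, (∑ e' : ({0} : Finset (B1Eq324BenfattoLemma.Site d)), w (0 : B1Eq324BenfattoLemma.Site d) e' ≤ B) → 0 ≤ B :=
    fun w hw B hB => le_trans (Finset.sum_nonneg fun e' _ => hw _ _) hB
  have hV0 := hrow_nonneg (fun x y => Real.exp (-(θ * Real.sqrt (∑ j, (((x j : ℝ) - (y j : ℝ))) ^ 2))) *
      (1 + Real.sqrt (∑ j, (((x j : ℝ) - (y j : ℝ))) ^ 2))) (fun x y => by positivity)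
    (B1Eq324BenfattoClassEntryRows.classRow_V_le hθ ⟨0, hone⟩)
  have hV₂0 := hrow_nonneg (fun x y => Real.exp (-(θ / 2 * Real.sqrt (∑ j, (((x j : ℝ) - (y j : ℝ))) ^ 2)))) (fun x y => by positivity)
    (B1Eq324BenfattoClassEntryRows.classRow_V₂_le hθ ⟨0, hone⟩)
  have hV₄0 := hrow_nonneg (fun x y => Real.exp (-(θ / 4 * Real.sqrt (∑ j, (((x j : ℝ) - (y j : ℝ))) ^ 2))) *
      (1 + Real.sqrt (∑ j, (((x j : ℝ) - (y j : ℝ))) ^ 2))) (fun x y => by positivity)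
    (B1Eq324BenfattoClassEntryRows.classRow_V₄_le hθ ⟨0, hone⟩)
  exact eq324_of_classSigned_noPad_on_unit hγA0 hJc0
    (B1Eq324BenfattoKernelSect5ClassBasicLemma.classBasicLemma_signed hd hγA2 hJc0 hJcγ hθ hV0 (le_max_of_le_left hM0) hV₂0
      (le_max_of_le_left hM₂0) hV₄0)
    (fun Λ₀ e => B1Eq324BenfattoClassEntryRows.classRow_V_le hθ e) (fun Λ₀ e => B1Eq324BenfattoClassEntryRows.classRow_V₂_le hθ e)
    (fun Λ₀ e => B1Eq324BenfattoClassEntryRows.classRow_V₄_le hθ e) t D hϰ hp₀ hσ hc hκ hκσ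


end Literature.MathematicalPhysics.QuantumFieldTheory.Balaban1983to89.B1Eq324BenfattoKernelEq324UnitRange

end
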